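import Mathlib.GroupTheory.Perm.Sign
import Mathlib.Tactic.Group
import Literature.NumberTheory.FaltingsSerre.GSp4F2Hom
import Literature.NumberTheory.FaltingsSerre.Criterion
import HarnessLib

/-!
# The Faltings–Serre method after Brumer–Pacetti–Poor–Tornaría–Voight–Yuen:
# lifting `ι(S₆) = Sp₄(𝔽₂)` to `Sp₄(ℤ₂)` and RE-FRAMING so that `ρ̄₁ = ρ̄₂` — PROVED

[BPPTVY] = A. Brumer, A. Pacetti, C. Poor, G. Tornaría, J. Voight, D. S. Yuen, *On the paramodularity of
typical abelian surfaces*, Algebra & Number Theory **13**:5 (2019) 1145–1195 [cite: BrumerEtAl2019].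

## What this file supplies (typer unit `pub-paramod`, DIVERGENCE.md D-22)

[BPPTVY, §2.3 p. 1149]: "*let `ρ₁, ρ₂ : Gal_{F,S} → G(ℤ_ℓ)` be representations such that
`ρ₁ ≃ ρ₂ (mod ℓ^r)` … Conjugating `ρ₂`, we may assume `ρ₁ ≡ ρ₂ (mod ℓ^r)`, and we write
`ρ̄ := ρ̄₁ = ρ̄₂` for the common residual representation*".  For `G = GSp₄`, `ℓ = 2`, `r = 1` this
"conjugating" needs an element of `G(ℤ₂)` — not merely of `GL₄(ℤ₂)` — reducing to the given residual
conjugator, so that `ρ₂` stays `G`-valued with the SAME similitude character.  The tree's certificate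
schema (`Literature.NumberTheory.FaltingsSerre.Paramodular.Certificate`, field `residual_eq`) asks for
the literal equality `ρ̄_A = ρ̄_f` of residual representations `Γ → GL₄(𝔽₂)` together with
`similitude₂ : IsSimilitude J (ν σ) (ρ_f σ)`; the residual-rigidity theorems
(`Literature.NumberTheory.FaltingsSerre.GSp4F2.exists_conj_of_ker_iff_of_range_S5b`, `…_S3wrS2`,
`…_of_transvection`, `…_of_trace_orderThree`) deliver `ρ̄_f = ι(π) ρ̄_A ι(π)⁻¹` for some `π ∈ S₆`
(`ι : S₆ ⥲ Sp₄(𝔽₂)`, [BPPTVY, (5.1.2) p. 1173]).  This file closes the gap, kernel-checked: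

* `antiIdAlt4 k` — the ALTERNATING anti-identity `J = antidiag(1, 1, -1, -1)` over any commutative ring
  (`Jᵀ = -J`, zero diagonal, `J² = -1`), whose reduction mod `2` is the tree's `antiId4 (ZMod 2)`, the
  Gram matrix of [BPPTVY, (5.1.2)]; it satisfies the `transpose_eq` / `diag_eq` fields of the
  certificate schema (`antiIdAlt4_transpose`, `antiIdAlt4_apply_same`), and `det J = 1`
  (`det_antiIdAlt4`, `isUnit_det_antiIdAlt4` = the `det_isUnit` field; `antiIdAlt4_map_toZMod`).
* `transvLift a b ∈ M₄(ℤ)` — the integral symplectic transvection `x ↦ x + B(x, ṽ) ṽ`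
  (`B(x, y) = xᵀ J y`, `ṽ ∈ {0,1}⁴` the lift of the class of `e_a + e_b` in `Z = U⁰/L`), and the
  kernel fact `transvLift_spec`: it is `J`-symplectic over `ℤ` and reduces mod `2` to `ι((a b))` for all
  `a ≠ b`.
* `exists_int_symplectic_lift`: every `ι(π)`, `π ∈ S₆`, lifts to `Sp(J)(ℤ)` (transpositions generate
  `S₆`, `Equiv.Perm.closure_isSwap`; products of lifts lift products, `iota_mul`).
* `unitOfSymplectic`: a `J`-symplectic matrix is a unit (`M⁻¹ = -J Mᵀ J`); `exists_GL_symplectic_lift`: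
  a lift `g ∈ GL₄(ℤ₂)` with `IsSimilitude (antiIdAlt4 ℤ_[2]) 1 g` and
  `GL₄(PadicInt.toZMod) g = iotaGL π`.
* `isSimilitude_conj`: conjugation by a multiplier-`1` similitude preserves `IsSimilitude J c`.
* `residual_conj_eq_of_residual_conj`, `exists_symplectic_reframe`: from
  `∀ γ, ρ̄₂ γ = ι(π) ρ̄₁ γ ι(π)⁻¹` an explicit `P ∈ Sp(J)(ℤ₂)` with
  `residual (P ρ₂ P⁻¹) = residual ρ₁` — literally the `residual_eq` field, for the conjugate
  `(MulAut.conj P).toMonoidHom.comp ρ₂ = (FramedRep.conj P ρ₂).toMonoidHom`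
  (`Literature.NumberTheory.GaloisRepresentations.FramedRep.conj`, by `rfl`).

Everything here is elementary linear algebra over `ℤ`, `ℤ₂`, `𝔽₂` and is PROVED (no cited facts);
the `[cite:]` tags record which sentence of [BPPTVY] each item implements.

## References
* [BPPTVY] ANT 13:5 (2019): §2.1 p. 1150 (residual representation), §2.3 p. 1149 ("Conjugating `ρ₂`,
  we may assume `ρ₁ ≡ ρ₂ (mod ℓ^r)`"), §5.1 (5.1.1)–(5.1.2) p. 1173 (`ι`, `J`, `ι(S₆) = Sp₄(𝔽₂)`).
  [cite: BrumerEtAl2019]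
-/

namespace Literature.NumberTheory.FaltingsSerre.GSp4F2

open Matrix Equiv Equiv.Perm
open Literature.NumberTheory.GaloisRepresentations (IsSimilitude isSimilitude_one_iff)
open Literature.NumberTheory.FaltingsSerre (residual)

section Form

variable (k : Type*) [CommRing k]

/-- The alternating anti-identity `J = antidiag(1, 1, -1, -1) ∈ M₄(k)`: an integral (characteristic-free)
form of the Gram matrix `antiId4 (ZMod 2)` of [BPPTVY, (5.1.2)]. [cite: BrumerEtAl2019, (5.1.2) p. 1173] -/
def antiIdAlt4 : Matrix (Fin 4) (Fin 4) k :=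
  !![0, 0, 0, 1; 0, 0, 1, 0; 0, -1, 0, 0; -1, 0, 0, 0]

/-- `Jᵀ = -J` (the `transpose_eq` field of the certificate schema). [folklore] -/
theorem antiIdAlt4_transpose : (antiIdAlt4 k)ᵀ = -antiIdAlt4 k := by
  ext i j; fin_cases i <;> fin_cases j <;> simp [antiIdAlt4]

/-- `J i i = 0` (the `diag_eq` field of the certificate schema). [folklore] -/
theorem antiIdAlt4_apply_same (i : Fin 4) : antiIdAlt4 k i i = 0 := by
  fin_cases i <;> simp [antiIdAlt4]

/-- `J² = -1`. [folklore] -/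
theorem antiIdAlt4_mul_self : antiIdAlt4 k * antiIdAlt4 k = -1 := by
  ext i j; fin_cases i <;> fin_cases j <;> simp [antiIdAlt4]

variable {k}

/-- `J` is compatible with every ring homomorphism. [folklore] -/
theorem antiIdAlt4_map {k' : Type*} [CommRing k'] (f : k →+* k') :
    (antiIdAlt4 k).map f = antiIdAlt4 k' := by
  ext i j; fin_cases i <;> fin_cases j <;> simp [antiIdAlt4]

/-- `J mod 2` is the tree's `antiId4 (ZMod 2)`, the Gram matrix of `Z = U⁰/L` [BPPTVY, (5.1.2)]. [cite: BrumerEtAl2019, (5.1.2) p. 1173] -/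
theorem antiIdAlt4_zmod2 : antiIdAlt4 (ZMod 2) = antiId4 (ZMod 2) := by
  unfold antiIdAlt4 antiId4; decide

/-- `det J = 1` over `ℤ` (kernel computation). [folklore] -/
theorem det_antiIdAlt4_int : (antiIdAlt4 ℤ).det = 1 := by
  unfold antiIdAlt4; decide +kernel

/-- `det J = 1` over every commutative ring (the `det_isUnit` field of the certificate schema for
`J = antiIdAlt4 ℤ_[ℓ]`). [folklore] -/
theorem det_antiIdAlt4 (k' : Type*) [CommRing k'] : (antiIdAlt4 k').det = 1 := by
  rw [← antiIdAlt4_map (Int.castRingHom k'), ← RingHom.mapMatrix_apply, ← RingHom.map_det,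
    det_antiIdAlt4_int, map_one]

/-- `IsUnit (det J)` (literally the `det_isUnit` field of
`Literature.NumberTheory.FaltingsSerre.Paramodular.Certificate`). [folklore] -/
theorem isUnit_det_antiIdAlt4 (k' : Type*) [CommRing k'] : IsUnit (antiIdAlt4 k').det := by
  rw [det_antiIdAlt4]; exact isUnit_one

/-- The reduction of `J = antiIdAlt4 ℤ_[2]` under `PadicInt.toZMod` is the tree's `antiId4 (ZMod 2)` (so the
schema's `spLie (J.map PadicInt.toZMod)` is `𝔰𝔭₄(𝔽₂)` for the Gram matrix of [BPPTVY, (5.1.2)], the Lie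
algebra of `Literature.NumberTheory.FaltingsSerre.Deviation`). [cite: BrumerEtAl2019, (5.1.2) p. 1173] -/
theorem antiIdAlt4_map_toZMod :
    (antiIdAlt4 ℤ_[2]).map (PadicInt.toZMod (p := 2)) = antiId4 (ZMod 2) := by
  rw [antiIdAlt4_map, antiIdAlt4_zmod2]

/-- A `J`-symplectic matrix `M` (`Mᵀ J M = J`) has the left inverse `-J Mᵀ J`. [folklore] -/
theorem neg_J_transpose_J_mul_eq_one {M : Matrix (Fin 4) (Fin 4) k}
    (h : Mᵀ * antiIdAlt4 k * M = antiIdAlt4 k) :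
    -(antiIdAlt4 k * Mᵀ * antiIdAlt4 k) * M = 1 := by
  calc -(antiIdAlt4 k * Mᵀ * antiIdAlt4 k) * M
      = -(antiIdAlt4 k * (Mᵀ * antiIdAlt4 k * M)) := by simp only [Matrix.mul_assoc, neg_mul]
    _ = 1 := by rw [h, antiIdAlt4_mul_self, neg_neg]

/-- A `J`-symplectic matrix over a commutative ring is a unit: the element of `GL₄(k)` with inverse
`-J Mᵀ J`. [folklore] -/
def unitOfSymplectic (M : Matrix (Fin 4) (Fin 4) k) (h : Mᵀ * antiIdAlt4 k * M = antiIdAlt4 k) :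
    GL (Fin 4) k where
  val := M
  inv := -(antiIdAlt4 k * Mᵀ * antiIdAlt4 k)
  val_inv := mul_eq_one_comm.1 (neg_J_transpose_J_mul_eq_one h)
  inv_val := neg_J_transpose_J_mul_eq_one h

/-- Unfolding lemma for `unitOfSymplectic`. [folklore] -/
@[simp] theorem coe_unitOfSymplectic (M : Matrix (Fin 4) (Fin 4) k)
    (h : Mᵀ * antiIdAlt4 k * M = antiIdAlt4 k) :
    ((unitOfSymplectic M h : GL (Fin 4) k) : Matrix (Fin 4) (Fin 4) k) = M := rfl

/-- Conjugation by a multiplier-`1` similitude `P` of `J` preserves "similitude of `J` with multiplier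
`c`": `(P M P⁻¹)ᵀ J (P M P⁻¹) = c J` whenever `Mᵀ J M = c J` (so re-framing by `P ∈ Sp(J)` keeps the
`similitude₂` field of the certificate schema with the same `ν`). [folklore] -/
theorem isSimilitude_conj {n : Type*} [Fintype n] [DecidableEq n] {J : Matrix n n k} {c : k}
    (P : GL n k) (hP : IsSimilitude J 1 (P : Matrix n n k)) {M : Matrix n n k}
    (hM : IsSimilitude J c M) :
    IsSimilitude J c ((P : Matrix n n k) * M * ((P⁻¹ : GL n k) : Matrix n n k)) := by
  rw [isSimilitude_one_iff] at hP
  unfold IsSimilitude at hM ⊢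
  set Q : Matrix n n k := ((P⁻¹ : GL n k) : Matrix n n k) with hQdef
  have hPQ : (P : Matrix n n k) * Q = 1 := Units.mul_inv P
  have hQ : Qᵀ * J * Q = J := by
    calc Qᵀ * J * Q = Qᵀ * ((P : Matrix n n k)ᵀ * J * P) * Q := by rw [hP]
      _ = ((P : Matrix n n k) * Q)ᵀ * J * ((P : Matrix n n k) * Q) := by
          rw [Matrix.transpose_mul]; simp only [Matrix.mul_assoc]
      _ = J := by rw [hPQ, Matrix.transpose_one, Matrix.one_mul, Matrix.mul_one]
  calc ((P : Matrix n n k) * M * Q)ᵀ * J * ((P : Matrix n n k) * M * Q)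
      = Qᵀ * (Mᵀ * ((P : Matrix n n k)ᵀ * J * P) * M) * Q := by
          rw [Matrix.transpose_mul, Matrix.transpose_mul]; simp only [Matrix.mul_assoc]
    _ = Qᵀ * (c • J) * Q := by rw [hP, hM]
    _ = c • J := by rw [Matrix.mul_smul, Matrix.smul_mul, hQ]

end Form

section Lift

/-- The `{0,1}`-lift `ṽ ∈ ℤ⁴` of the class of `e_a + e_b` in `Z = U⁰/L ≃ 𝔽₂⁴` (coordinates via the
retraction `projZ`), the direction of the transvection `ι((a b))` [BPPTVY, §5.1 p. 1173: a transposition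
acts on `Z` by a symplectic transvection]. [cite: BrumerEtAl2019, (5.1.1)–(5.1.2) p. 1173] -/
def vLift (a b : Fin 6) : Fin 4 → ℤ :=
  fun i => (((projZ *ᵥ (Pi.single a 1 + Pi.single b 1)) i).val : ℤ)

/-- The integral symplectic transvection `T_{a b} = 1 + ṽ ṽᵀ J ∈ M₄(ℤ)`, `x ↦ x + (ṽᵀ J x) ṽ`, lifting
`ι((a b))`. [cite: BrumerEtAl2019, (5.1.1)–(5.1.2) p. 1173] -/
def transvLift (a b : Fin 6) : Matrix (Fin 4) (Fin 4) ℤ :=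
  1 + vecMulVec (vLift a b) (vLift a b ᵥ* antiIdAlt4 ℤ)

set_option maxHeartbeats 400000 in
/-- KERNEL FACT: for all `a ≠ b`, `T_{a b}` is `J`-symplectic over `ℤ` and `T_{a b} mod 2 = ι((a b))`
(30 ordered pairs, `4 × 4` integer arithmetic). [cite: BrumerEtAl2019, (5.1.1)–(5.1.2) p. 1173] -/
theorem transvLift_spec : ∀ a b : Fin 6, a ≠ b →
    (transvLift a b)ᵀ * antiIdAlt4 ℤ * transvLift a b = antiIdAlt4 ℤ ∧
      (transvLift a b).map (Int.castRingHom (ZMod 2)) = iota (swap a b) := by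
  unfold transvLift vLift iota projZ basisZ permAction antiIdAlt4
  decide +kernel

/-- **`ι(S₆) = Sp₄(𝔽₂)` lifts to `Sp₄(ℤ)`**: every `ι(π)` is the reduction mod `2` of a `J`-symplectic
integral matrix (`S₆` is generated by transpositions; lift each by `transvLift`, multiply). This is the
integral refinement of [BPPTVY, (5.1.2)] used for "conjugating `ρ₂`" in [BPPTVY, §2.3 p. 1149] with
`G = GSp₄`. [cite: BrumerEtAl2019, (5.1.2) p. 1173 and §2.3 p. 1149] -/
theorem exists_int_symplectic_lift (π : Perm (Fin 6)) :
    ∃ M : Matrix (Fin 4) (Fin 4) ℤ,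
      Mᵀ * antiIdAlt4 ℤ * M = antiIdAlt4 ℤ ∧ M.map (Int.castRingHom (ZMod 2)) = iota π := by
  have hmem : π ∈ (Subgroup.closure {σ : Perm (Fin 6) | σ.IsSwap}).toSubmonoid := by
    rw [Equiv.Perm.closure_isSwap]; exact Subgroup.mem_top π
  rw [Subgroup.closure_toSubmonoid_of_finite] at hmem
  induction hmem using Submonoid.closure_induction with
  | mem x hx =>
    obtain ⟨a, b, hab, rfl⟩ := hx
    exact ⟨transvLift a b, transvLift_spec a b hab⟩
  | one =>
    refine ⟨1, by rw [Matrix.transpose_one, Matrix.mul_one, Matrix.one_mul], ?_⟩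
    rw [Matrix.map_one _ (map_zero _) (map_one _), iota_one]
  | mul x y _ _ hx hy =>
    obtain ⟨M, hM, hMx⟩ := hx
    obtain ⟨N, hN, hNy⟩ := hy
    refine ⟨M * N, ?_, ?_⟩
    · rw [Matrix.transpose_mul,
        show Nᵀ * Mᵀ * antiIdAlt4 ℤ * (M * N) = Nᵀ * (Mᵀ * antiIdAlt4 ℤ * M) * N by
          simp only [Matrix.mul_assoc], hM, hN]
    · rw [Matrix.map_mul, hMx, hNy, iota_mul]

/-- **The residual conjugator lifts to `Sp₄(ℤ₂)`**: for every `π ∈ S₆` there is `g ∈ GL₄(ℤ₂)` with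
`gᵀ J g = J` (`J = antiIdAlt4 ℤ_[2]`) whose reduction `GL₄(PadicInt.toZMod) g` is `iotaGL π`.
[cite: BrumerEtAl2019, §2.3 p. 1149 and (5.1.2) p. 1173] -/
theorem exists_GL_symplectic_lift (π : Perm (Fin 6)) :
    ∃ g : GL (Fin 4) ℤ_[2], IsSimilitude (antiIdAlt4 ℤ_[2]) 1 (g : Matrix (Fin 4) (Fin 4) ℤ_[2]) ∧
      Matrix.GeneralLinearGroup.map (PadicInt.toZMod (p := 2)) g = iotaGL π := by
  obtain ⟨M, hM, hMπ⟩ := exists_int_symplectic_lift π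
  have hM' : (M.map (Int.castRingHom ℤ_[2]))ᵀ * antiIdAlt4 ℤ_[2] * M.map (Int.castRingHom ℤ_[2]) =
      antiIdAlt4 ℤ_[2] := by
    have := congrArg (fun A : Matrix (Fin 4) (Fin 4) ℤ => A.map (Int.castRingHom ℤ_[2])) hM
    simpa only [Matrix.map_mul, ← Matrix.transpose_map, antiIdAlt4_map] using this
  refine ⟨unitOfSymplectic _ hM', isSimilitude_one_iff.2 hM', ?_⟩
  apply Matrix.GeneralLinearGroup.ext
  intro i j
  show ((M.map (Int.castRingHom ℤ_[2])).map (PadicInt.toZMod (p := 2))) i j = _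
  rw [coe_iotaGL, ← hMπ]
  simp only [Matrix.map_apply, eq_intCast, map_intCast]

end Lift

section Reframe

variable {Γ : Type*} [Group Γ]

/-- **Re-framing gives literal equality of residual representations.**  If `ρ̄₂ = ḡ ρ̄₁ ḡ⁻¹`
pointwise and `P ∈ GL₄(ℤ₂)` reduces to `ḡ⁻¹`, then the conjugate `P ρ₂ P⁻¹`
(`= (FramedRep.conj P ρ₂).toMonoidHom` when `ρ₂` is a framed continuous representation) has
`residual (P ρ₂ P⁻¹) = residual ρ₁` — the "we may assume `ρ₁ ≡ ρ₂ (mod ℓ)`, `ρ̄ := ρ̄₁ = ρ̄₂`" of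
[BPPTVY, §2.3], i.e. the `residual_eq` field of the certificate schema. [cite: BrumerEtAl2019, §2.3 p. 1149 and §2.1 p. 1150] -/
theorem residual_conj_eq_of_residual_conj (ρ₁ ρ₂ : Γ →* GL (Fin 4) ℤ_[2])
    {gbar : GL (Fin 4) (ZMod 2)} (h : ∀ γ, residual ρ₂ γ = gbar * residual ρ₁ γ * gbar⁻¹)
    {P : GL (Fin 4) ℤ_[2]} (hP : Matrix.GeneralLinearGroup.map (PadicInt.toZMod (p := 2)) P = gbar⁻¹) :
    residual ((MulAut.conj P).toMonoidHom.comp ρ₂) = residual ρ₁ := by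
  ext1 γ
  have e : residual ((MulAut.conj P).toMonoidHom.comp ρ₂) γ =
      Matrix.GeneralLinearGroup.map (PadicInt.toZMod (p := 2)) P * residual ρ₂ γ *
        (Matrix.GeneralLinearGroup.map (PadicInt.toZMod (p := 2)) P)⁻¹ := by
    simp only [residual, MonoidHom.comp_apply, MulEquiv.coe_toMonoidHom, MulAut.conj_apply, map_mul,
      map_inv]
  rw [e, h γ, hP]
  group

/-- **Symplectic re-framing** (the form the certificate producers instantiate): if
`ρ̄₂ = ι(π) ρ̄₁ ι(π)⁻¹` pointwise for some `π ∈ S₆` — the output of the residual-rigidity theorems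
`exists_conj_of_ker_iff_of_range_S5b` / `…_S3wrS2` / `…_of_transvection` / `…_of_trace_orderThree` —
then there is `P ∈ GL₄(ℤ₂)` with `Pᵀ J P = J` (`J = antiIdAlt4 ℤ_[2]`; so `P ρ₂ P⁻¹` has the same
similitude character for `J`, `isSimilitude_conj`), reducing to `ι(π)⁻¹`, and
`residual (P ρ₂ P⁻¹) = residual ρ₁`. [cite: BrumerEtAl2019, §2.3 p. 1149 and (5.1.2) p. 1173] -/
theorem exists_symplectic_reframe (ρ₁ ρ₂ : Γ →* GL (Fin 4) ℤ_[2]) (π : Perm (Fin 6))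
    (h : ∀ γ, residual ρ₂ γ = iotaGL π * residual ρ₁ γ * (iotaGL π)⁻¹) :
    ∃ P : GL (Fin 4) ℤ_[2], IsSimilitude (antiIdAlt4 ℤ_[2]) 1 (P : Matrix (Fin 4) (Fin 4) ℤ_[2]) ∧
      Matrix.GeneralLinearGroup.map (PadicInt.toZMod (p := 2)) P = (iotaGL π)⁻¹ ∧
      residual ((MulAut.conj P).toMonoidHom.comp ρ₂) = residual ρ₁ := by
  obtain ⟨P, hPs, hPr⟩ := exists_GL_symplectic_lift π⁻¹
  rw [map_inv] at hPr
  exact ⟨P, hPs, hPr, residual_conj_eq_of_residual_conj ρ₁ ρ₂ h hPr⟩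

/-- The same with the similitude bookkeeping spelled out: every `σ` at which `ρ₂` is a similitude of
`J = antiIdAlt4 ℤ_[2]` with multiplier `c` stays one after re-framing (fields `similitude₂`,
`residual_eq` of `Literature.NumberTheory.FaltingsSerre.Paramodular.Certificate` for the conjugate).
[cite: BrumerEtAl2019, §2.3 p. 1149] -/
theorem exists_symplectic_reframe' (ρ₁ ρ₂ : Γ →* GL (Fin 4) ℤ_[2]) (π : Perm (Fin 6))
    (h : ∀ γ, residual ρ₂ γ = iotaGL π * residual ρ₁ γ * (iotaGL π)⁻¹) :
    ∃ P : GL (Fin 4) ℤ_[2],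
      residual ((MulAut.conj P).toMonoidHom.comp ρ₂) = residual ρ₁ ∧
      ∀ (γ : Γ) (c : ℤ_[2]), IsSimilitude (antiIdAlt4 ℤ_[2]) c ((ρ₂ γ : GL (Fin 4) ℤ_[2]) : Matrix (Fin 4) (Fin 4) ℤ_[2]) →
        IsSimilitude (antiIdAlt4 ℤ_[2]) c
          ((((MulAut.conj P).toMonoidHom.comp ρ₂) γ : GL (Fin 4) ℤ_[2]) : Matrix (Fin 4) (Fin 4) ℤ_[2]) := by
  obtain ⟨P, hPs, -, hres⟩ := exists_symplectic_reframe ρ₁ ρ₂ π h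
  refine ⟨P, hres, fun γ c hc => ?_⟩
  have e : ((((MulAut.conj P).toMonoidHom.comp ρ₂) γ : GL (Fin 4) ℤ_[2]) : Matrix (Fin 4) (Fin 4) ℤ_[2]) =
      (P : Matrix (Fin 4) (Fin 4) ℤ_[2]) * ((ρ₂ γ : GL (Fin 4) ℤ_[2]) : Matrix (Fin 4) (Fin 4) ℤ_[2]) *
        ((P⁻¹ : GL (Fin 4) ℤ_[2]) : Matrix (Fin 4) (Fin 4) ℤ_[2]) := by
    simp only [MonoidHom.comp_apply, MulEquiv.coe_toMonoidHom, MulAut.conj_apply, Units.val_mul]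
  rw [e]
  exact isSimilitude_conj P hPs hc

/-- **Framed form** (continuous representations `ρ₁, ρ₂ : G →ₜ* GL₄(ℤ₂)`, as in the certificate schema
`Literature.NumberTheory.FaltingsSerre.Paramodular.Certificate`): from `ρ̄₂ = ι(π) ρ̄₁ ι(π)⁻¹` an explicit
symplectic `P` such that the re-framed `FramedRep.conj P ρ₂ = P ρ₂ P⁻¹`
(`Literature.NumberTheory.GaloisRepresentations.FramedRep.conj`) satisfies the `residual_eq` field
`residual (P ρ₂ P⁻¹) = residual ρ₁` literally, and keeps every `similitude₂` instance
`IsSimilitude J c (ρ₂ σ)` for `J = antiIdAlt4 ℤ_[2]` with the same multiplier. [cite: BrumerEtAl2019, §2.3 p. 1149 and (5.1.2) p. 1173] -/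
theorem exists_symplectic_reframe_framed {G : Type*} [Group G] [TopologicalSpace G]
    (ρ₁ ρ₂ : Literature.NumberTheory.GaloisRepresentations.FramedRep G ℤ_[2] 4) (π : Perm (Fin 6))
    (h : ∀ γ, residual ρ₂.toMonoidHom γ = iotaGL π * residual ρ₁.toMonoidHom γ * (iotaGL π)⁻¹) :
    ∃ P : GL (Fin 4) ℤ_[2], IsSimilitude (antiIdAlt4 ℤ_[2]) 1 (P : Matrix (Fin 4) (Fin 4) ℤ_[2]) ∧
      residual (Literature.NumberTheory.GaloisRepresentations.FramedRep.conj P ρ₂).toMonoidHom =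
        residual ρ₁.toMonoidHom ∧
      ∀ (γ : G) (c : ℤ_[2]),
        IsSimilitude (antiIdAlt4 ℤ_[2]) c ((ρ₂ γ : GL (Fin 4) ℤ_[2]) : Matrix (Fin 4) (Fin 4) ℤ_[2]) →
        IsSimilitude (antiIdAlt4 ℤ_[2]) c
          ((Literature.NumberTheory.GaloisRepresentations.FramedRep.conj P ρ₂ γ : GL (Fin 4) ℤ_[2]) :
            Matrix (Fin 4) (Fin 4) ℤ_[2]) := by
  obtain ⟨P, hPs, -, hres⟩ := exists_symplectic_reframe ρ₁.toMonoidHom ρ₂.toMonoidHom π h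
  refine ⟨P, hPs, hres, fun γ c hc => ?_⟩
  rw [Literature.NumberTheory.GaloisRepresentations.FramedRep.conj_apply, Units.val_mul, Units.val_mul]
  exact isSimilitude_conj P hPs hc

end Reframe

end Literature.NumberTheory.FaltingsSerre.GSp4F2
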